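import Summits.BirchSwinnertonDyer.Rank1Residual.X5.SelmerSolitaire
import HarnessLib

/-!
# Selmer solitaire: the REPAIRED word-shape T4′ `Bad1ThreePrimeConnection'` and the refutation of the
# unrepaired one

Cell `b2b-bsdres`, O1 (p = 2) PROVER ORDER v2.8 (ii′); spelling of record R-G18.2 ≡ lens-2 2G9.8 (d)
(o1 lead GEN 18 + lens-2 GEN 9 + x11b3-p2 GEN 5 + x11b3-p4 GEN 4 concurring).  Pure 𝔽₂ linear algebra;
reach-neutral; nothing arithmetic asserted; nothing booked; no mark; O1 OPEN.  HONEST FRAMING (cell,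
verbatim): research route; ONE definition of a `Prop` (nothing asserted by it) + one theorem.

* `Bad1ThreePrimeConnection'` — `Bad1ThreePrimeConnection` (p272248, UNTOUCHED) with the non-degeneracy
  clause `A.Nonempty ∨ ε₀ = 1` ("`c₀ ≠ 0`": `(∅, 0)` is not a BAD₁ instance) right after the binders of
  `A, ε₀`.  Its proof (`bad1ThreePrimeConnection'_holds`) is the T4′ assembly file.
* `not_bad1ThreePrimeConnection` — the unrepaired word-shape is FALSE: at `s = 0`, `A = ∅`, `ε₀ = 0`
  no move is admissible (the admissibility identity reads `0 = 1`).  (x11b3-p2 GEN 5's finding.)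

References: lens-2 GEN 5/9, ROUTES-O1 §lens-2 G5.9, 2G9.8 (d); B. Mazur, K. Rubin, *Kolyvagin systems*
(2004) §4.3. [cite: MazurRubin2004, §4.3]
-/

namespace Summit.BirchSwinnertonDyer.Rank1Residual.X5.SelmerSolitaire

open Finset

/-- T4′ (BAD₁ CLOSURE), REPAIRED pure form: on a BAD₁-decorated position with `c₀ ≠ 0`
(`A.Nonempty ∨ ε₀ = 1`), `∅` and any core `B` become connected in `𝒳⁰` after three successive
admissible one-vertex extensions. (lens-2 G5.9 / 2G9.8 (d); a `Prop`, nothing asserted here.)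
[cite: MazurRubin2004, §4.3] -/
def Bad1ThreePrimeConnection' : Prop :=
  ∀ (s : ℕ) (P : Position s) (A : Finset (Fin s)) (ε₀ : ZMod 2), (A.Nonempty ∨ ε₀ = 1) →
    ∀ (B : Finset (Fin s)), Bad1Consistent P A ε₀ → Core P B →
    ∃ (P₁ : Position (s + 1)) (P₂ : Position (s + 2)) (P₃ : Position (s + 3)),
      AdmissibleExtends P A ε₀ P₁ ∧ AdmissibleExtends P₁ (lift A) ε₀ P₂ ∧
        AdmissibleExtends P₂ (lift (lift A)) ε₀ P₃ ∧ Connected P₃ ∅ (lift (lift (lift B)))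

/-- **The unrepaired T4′ is false**: witness `s = 0`, the empty graph on `{∞}`, `A = ∅`, `ε₀ = 0`,
`B = ∅` — no extension is admissible. [folklore] -/
theorem not_bad1ThreePrimeConnection : ¬ Bad1ThreePrimeConnection := by
  intro h
  let P : Position 0 := ⟨0, Matrix.transpose_zero, fun _ => rfl⟩
  have hc : Bad1Consistent P ∅ 0 := fun v => v.elim0
  have hB : Core P ∅ := by
    unfold Core
    have h0 : plus (∅ : Finset (Fin 0)) = ∅ := by simp [plus]
    haveI : IsEmpty ↥(plus (∅ : Finset (Fin 0))) := by rw [h0]; infer_instance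
    exact Matrix.det_isEmpty
  obtain ⟨P₁, _, _, ⟨_, h1⟩, -⟩ := h 0 P ∅ 0 ∅ hc hB
  rw [mul_zero, Finset.sum_empty, add_zero] at h1
  exact zero_ne_one h1

end Summit.BirchSwinnertonDyer.Rank1Residual.X5.SelmerSolitaire
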